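import Summits.RiemannHypothesis.RiemannHypothesis.Theorems.SignConeConeMagnificationPinch
import Summits.RiemannHypothesis.RiemannHypothesis.Theorems.SignConeConeMagnificationStubFakePNT
import Summits.RiemannHypothesis.RiemannHypothesis.Theorems.SignConeConeMagnificationStubChebyshev
import Summits.RiemannHypothesis.RiemannHypothesis.Theorems.SignConeConeMagnificationStubContinuation
import Summits.RiemannHypothesis.RiemannHypothesis.Theorems.SignConeConeMagnificationStubPdLaplace
import Summits.RiemannHypothesis.RiemannHypothesis.Theorems.SignConeConeMagnificationStubCara

/-!
# `ConeMagnification`: one-sided fake weights force RH (route `SignCone`, item stmt-RiemannHypothesis-16303;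
HELPER file, `--supports`)

Corollaries of the pinch (`not_lseriesSummable_posPart_of_not_riemannHypothesis`, p136750): for a weight `c ≥ 0`
with absolutely convergent `L_c` on `re s > 1` and `L_c − 1/(s−1)` the restriction of a function holomorphic on
`re s > 1/2` (in particular for every unit-slack weight, by the landed `Sketch` chain),

* `riemannHypothesis_of_surplus_summable` — if the SURPLUS series `Σ (c−Λ)₊(n) n^{-σ}` converges for every
  `σ > 1/2`, then RH (the deficit analogue is the Landau transfer `stub_transfer`; here no Landau argument on `ζ`
  is needed beyond the pinch);
* `riemannHypothesis_of_deficit_summable'` — the same with the DEFICIT series `Σ (Λ−c)₊(n) n^{-σ}`;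
* `riemannHypothesis_of_eventually_le_vonMangoldt` / `…_vonMangoldt_le` — in particular a weight that is
  eventually `≤ Λ` (pure deficit) or eventually `≥ Λ` (pure surplus) forces RH;
* `…_of_unitSlack` versions for unit-slack weights `c ≥ 0`, `c 1 = 0`.

So in the `¬RH` world of the open core an admissible fake weight crosses `Λ` infinitely often in both directions,
with non-summable excursions at every `σ < Θ` on both sides.
-/

noncomputable section

-- `Summit.RiemannHypothesis.RiemannHypothesis.…` repeats a namespace component by design (D-0017 layout).
set_option linter.dupNamespace false

open Complex Filter Set
open scoped ArithmeticFunction.vonMangoldt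

namespace Summit.RiemannHypothesis.RiemannHypothesis.Theorems.SignConeConeMagnification

open Literature.NumberTheory.LFunctions
open Summit.RiemannHypothesis.RiemannHypothesis.Cruxes.ConeMagnification.Sketch

/-- An eventually vanishing arithmetic function has an everywhere convergent `L`-series. [folklore] -/
theorem lseriesSummable_of_eventually_eq_zero {f : ℕ → ℂ} {N : ℕ} (hf : ∀ n, N ≤ n → f n = 0) (s : ℂ) :
    LSeriesSummable f s := by
  refine summable_of_ne_finset_zero (s := Finset.range N) fun n hn => ?_
  rw [Finset.mem_range, not_lt] at hn
  rcases eq_or_ne n 0 with rfl | h0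
  · exact LSeries.term_zero _ _
  · rw [LSeries.term_of_ne_zero h0, hf n hn, zero_div]

/-- **Surplus summable beyond `1/2` forces RH.** For `c ≥ 0` with `hsum`, `hcont`: if
`Σ (c−Λ)₊(n) n^{-σ} < ∞` for every `σ > 1/2` then the Riemann hypothesis holds (under `¬RH` the pinch makes
the surplus series diverge at some `σ > 1/2`). [folklore] -/
theorem riemannHypothesis_of_surplus_summable :
    ∀ c : ℕ → ℝ, (∀ n, 0 ≤ c n) →
    (∀ σ : ℝ, 1 < σ → LSeriesSummable (fun n => ((c n : ℝ) : ℂ)) σ) →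
    (∃ F : ℂ → ℂ, DifferentiableOn ℂ F {s : ℂ | 1 / 2 < s.re} ∧
      ∀ s : ℂ, 1 < s.re → F s = LSeries (fun n => ((c n : ℝ) : ℂ)) s - 1 / (s - 1)) →
    (∀ σ : ℝ, 1 / 2 < σ →
      LSeriesSummable (fun n => ((max (c n - ArithmeticFunction.vonMangoldt n) 0 : ℝ) : ℂ)) σ) →
    RiemannHypothesis := by
  intro c hc0 hsum hcont hS
  by_contra hRH
  obtain ⟨θ, hθ, hdiv⟩ := not_lseriesSummable_posPart_of_not_riemannHypothesis hRH c hc0 hsum hcont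
  exact (hdiv ((1 / 2 + θ) / 2) (by linarith)).1 (hS _ (by linarith))

/-- **Deficit summable beyond `1/2` forces RH** (from the pinch; cf. the Landau transfer `stub_transfer`,
which reaches the same conclusion from thin-rectangle continuations). [folklore] -/
theorem riemannHypothesis_of_deficit_summable' :
    ∀ c : ℕ → ℝ, (∀ n, 0 ≤ c n) →
    (∀ σ : ℝ, 1 < σ → LSeriesSummable (fun n => ((c n : ℝ) : ℂ)) σ) →
    (∃ F : ℂ → ℂ, DifferentiableOn ℂ F {s : ℂ | 1 / 2 < s.re} ∧
      ∀ s : ℂ, 1 < s.re → F s = LSeries (fun n => ((c n : ℝ) : ℂ)) s - 1 / (s - 1)) →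
    (∀ σ : ℝ, 1 / 2 < σ →
      LSeriesSummable (fun n => ((max (ArithmeticFunction.vonMangoldt n - c n) 0 : ℝ) : ℂ)) σ) →
    RiemannHypothesis := by
  intro c hc0 hsum hcont hD
  by_contra hRH
  obtain ⟨θ, hθ, hdiv⟩ := not_lseriesSummable_posPart_of_not_riemannHypothesis hRH c hc0 hsum hcont
  exact (hdiv ((1 / 2 + θ) / 2) (by linarith)).2 (hD _ (by linarith))

/-- **A pure-deficit fake weight forces RH**: if `c ≤ Λ` eventually (with `hsum`, `hcont`), then RH. [folklore] -/
theorem riemannHypothesis_of_eventually_le_vonMangoldt :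
    ∀ c : ℕ → ℝ, (∀ n, 0 ≤ c n) →
    (∀ σ : ℝ, 1 < σ → LSeriesSummable (fun n => ((c n : ℝ) : ℂ)) σ) →
    (∃ F : ℂ → ℂ, DifferentiableOn ℂ F {s : ℂ | 1 / 2 < s.re} ∧
      ∀ s : ℂ, 1 < s.re → F s = LSeries (fun n => ((c n : ℝ) : ℂ)) s - 1 / (s - 1)) →
    (∃ N : ℕ, ∀ n, N ≤ n → c n ≤ ArithmeticFunction.vonMangoldt n) → RiemannHypothesis := by
  intro c hc0 hsum hcont ⟨N, hN⟩
  refine riemannHypothesis_of_surplus_summable c hc0 hsum hcont fun σ _ => ?_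
  refine lseriesSummable_of_eventually_eq_zero (N := N) (fun n hn => ?_) _
  have : max (c n - ArithmeticFunction.vonMangoldt n) 0 = 0 := max_eq_right (by linarith [hN n hn])
  rw [this, Complex.ofReal_zero]

/-- **A pure-surplus fake weight forces RH**: if `Λ ≤ c` eventually (with `hsum`, `hcont`), then RH. [folklore] -/
theorem riemannHypothesis_of_eventually_vonMangoldt_le :
    ∀ c : ℕ → ℝ, (∀ n, 0 ≤ c n) →
    (∀ σ : ℝ, 1 < σ → LSeriesSummable (fun n => ((c n : ℝ) : ℂ)) σ) →
    (∃ F : ℂ → ℂ, DifferentiableOn ℂ F {s : ℂ | 1 / 2 < s.re} ∧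
      ∀ s : ℂ, 1 < s.re → F s = LSeries (fun n => ((c n : ℝ) : ℂ)) s - 1 / (s - 1)) →
    (∃ N : ℕ, ∀ n, N ≤ n → ArithmeticFunction.vonMangoldt n ≤ c n) → RiemannHypothesis := by
  intro c hc0 hsum hcont ⟨N, hN⟩
  refine riemannHypothesis_of_deficit_summable' c hc0 hsum hcont fun σ _ => ?_
  refine lseriesSummable_of_eventually_eq_zero (N := N) (fun n hn => ?_) _
  have : max (ArithmeticFunction.vonMangoldt n - c n) 0 = 0 := max_eq_right (by linarith [hN n hn])
  rw [this, Complex.ofReal_zero]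

/-! ## The same for unit-slack weights -/

/-- **A unit-slack weight with summable surplus OR summable deficit beyond `1/2` forces RH** (`hsum`,
`hcont` from the landed `Sketch` chain `stub_fakePNT`, `stub_chebyshev`, `stub_continuation`,
`stub_pdLaplace`, `stub_cara`). [folklore] -/
theorem riemannHypothesis_of_unitSlack_of_oneSided_summable :
    ∀ c : ℕ → ℝ, (∀ n, 0 ≤ c n) → c 1 = 0 →
    (∀ g : ℝ → ℂ, IsWeilTest g →
      -(∫ t, ‖g t‖ ^ 2) ≤
        (weilPolarTerm (weilConv g (weilReflect g)) + weilArchTerm (weilConv g (weilReflect g)) -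
          ∑' n : ℕ, ((c n : ℝ) : ℂ) / (Real.sqrt n : ℂ) *
            (weilConv g (weilReflect g) (Real.log n) + weilConv g (weilReflect g) (-Real.log n))).re) →
    ((∀ σ : ℝ, 1 / 2 < σ →
        LSeriesSummable (fun n => ((max (c n - ArithmeticFunction.vonMangoldt n) 0 : ℝ) : ℂ)) σ) ∨
      (∀ σ : ℝ, 1 / 2 < σ →
        LSeriesSummable (fun n => ((max (ArithmeticFunction.vonMangoldt n - c n) 0 : ℝ) : ℂ)) σ)) →
    RiemannHypothesis := by
  intro c hc0 hc1 hU h1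
  have hPNT := stub_fakePNT c hc0 hU
  have hsum := stub_chebyshev c hc0 hPNT
  have hcont := stub_continuation c hc0 hPNT hsum
  have hPD := stub_pdLaplace c hc0 hU
  obtain ⟨F, hFd, hFL, -⟩ := stub_cara c hc0 hc1 hU hsum hcont hPD
  rcases h1 with hS | hD
  · exact riemannHypothesis_of_surplus_summable c hc0 hsum ⟨F, hFd, hFL⟩ hS
  · exact riemannHypothesis_of_deficit_summable' c hc0 hsum ⟨F, hFd, hFL⟩ hD

/-- **A one-sided unit-slack weight forces RH**: if `c ≥ 0`, `c 1 = 0`, has unit slack against every Weil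
test and is eventually `≤ Λ` or eventually `≥ Λ`, then RH.  (In the `¬RH` world an admissible fake weight
crosses `Λ` infinitely often in both directions.) [folklore] -/
theorem riemannHypothesis_of_unitSlack_of_eventually_oneSided :
    ∀ c : ℕ → ℝ, (∀ n, 0 ≤ c n) → c 1 = 0 →
    (∀ g : ℝ → ℂ, IsWeilTest g →
      -(∫ t, ‖g t‖ ^ 2) ≤
        (weilPolarTerm (weilConv g (weilReflect g)) + weilArchTerm (weilConv g (weilReflect g)) -
          ∑' n : ℕ, ((c n : ℝ) : ℂ) / (Real.sqrt n : ℂ) *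
            (weilConv g (weilReflect g) (Real.log n) + weilConv g (weilReflect g) (-Real.log n))).re) →
    ((∃ N : ℕ, ∀ n, N ≤ n → c n ≤ ArithmeticFunction.vonMangoldt n) ∨
      (∃ N : ℕ, ∀ n, N ≤ n → ArithmeticFunction.vonMangoldt n ≤ c n)) →
    RiemannHypothesis := by
  intro c hc0 hc1 hU h1
  have hPNT := stub_fakePNT c hc0 hU
  have hsum := stub_chebyshev c hc0 hPNT
  have hcont := stub_continuation c hc0 hPNT hsum
  have hPD := stub_pdLaplace c hc0 hU
  obtain ⟨F, hFd, hFL, -⟩ := stub_cara c hc0 hc1 hU hsum hcont hPD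
  rcases h1 with hle | hge
  · exact riemannHypothesis_of_eventually_le_vonMangoldt c hc0 hsum ⟨F, hFd, hFL⟩ hle
  · exact riemannHypothesis_of_eventually_vonMangoldt_le c hc0 hsum ⟨F, hFd, hFL⟩ hge

end Summit.RiemannHypothesis.RiemannHypothesis.Theorems.SignConeConeMagnification

end
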